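import Summits.AtomisticToContinuum.BoseEinsteinCondensation.Theorems.BECHusimiAmplitudeGasPositivityReductionModulus
import Literature.MathematicalPhysics.QuantumManyBody.PeriodicClusteringFromKyFanGap
import HarnessLib

/-!
# Route BECHusimiAmplitudeGas — `PositivityReduction` (item stmt-AtomisticToContinuum-11998), part 4:
# nonnegative near-minimisers for EVERY pair potential (hard cores included)

Helper file (`--supports stmt-AtomisticToContinuum-11998`). Part 2 produced nonnegative
near-minimisers by the regularised modulus `Z⁻¹√(|Ψ|² + η²)`, whose energy exceeds that of `Ψ` by
`η² ∫_cell W` — useless when `W = ∑_{i<j} v^per(xᵢ - xⱼ)` is not integrable (hard cores, `v = ⊤` on a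
set of positive measure). Here the **shifted modulus** `f = √(|Ψ|² + η²) - η` is used instead: it is
`C¹`, periodic, Bose symmetric, `0 ≤ f ≤ |Ψ|` (so `W f² ≤ W|Ψ|²` even where `W = ⊤`: `f` vanishes
wherever `Ψ` does) and `|∇f| ≤ |∇Ψ|` (smooth diamagnetic inequality), whence the UNNORMALISED energy
of `f` is at most `periodicEnergy v Ψ` for every measurable `v`; and `‖f‖²_cell ≥ 1 - η(1 + L^{3N})`
(from `|Ψ|² ≤ f² + η(|Ψ|² + 1)` pointwise), so the normalised state `f/‖f‖_cell` has energy
`≤ periodicEnergy v Ψ / (1 - η(1 + L^{3N}))`. Consequently (`exists_nonneg_nearMinimiser_of_ne_top`):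
for every `v : ℝ → [0,∞]`, `L > 0` and finite `periodicGroundStateEnergy v N L`, nonnegative periodic
`C¹` Bose `δ`-near-minimisers exist for every `δ > 0`.
-/

noncomputable section

open MeasureTheory Filter Set Complex
open scoped ENNReal NNReal Topology ComplexConjugate InnerProductSpace RealInnerProductSpace

namespace Summit.AtomisticToContinuum.BoseEinsteinCondensation.Theorems

open Literature.MathematicalPhysics.QuantumManyBody.BoseGas Literature.MathematicalPhysics.QuantumManyBody

variable {N : ℕ} {L : ℝ}

/-- `‖(r : ℂ)‖₊² = ofReal (r²)` in `ℝ≥0∞` (private copy). [folklore] -/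
private theorem ennnorm_sq_ofReal_sm (r : ℝ) : ((‖(r : ℂ)‖₊ : ℝ≥0∞)) ^ 2 = ENNReal.ofReal (r ^ 2) := by
  rw [coe_nnnorm_sq_eq_ofReal, Complex.norm_real, Real.norm_eq_abs, sq_abs]

/-! ### Real inequalities for the shifted modulus `√(a² + η²) - η` -/

/-- `0 ≤ √(a² + η²) - η` for `η ≥ 0`. [folklore] -/
theorem shiftedModulus_nonneg (a : ℝ) {η : ℝ} (hη : 0 ≤ η) : 0 ≤ Real.sqrt (a ^ 2 + η ^ 2) - η := by
  rw [sub_nonneg, Real.le_sqrt hη (by positivity)]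
  nlinarith [sq_nonneg a]

/-- `√(a² + η²) - η ≤ a` for `a, η ≥ 0`. [folklore] -/
theorem shiftedModulus_le {a η : ℝ} (ha : 0 ≤ a) (hη : 0 ≤ η) : Real.sqrt (a ^ 2 + η ^ 2) - η ≤ a := by
  rw [sub_le_iff_le_add, Real.sqrt_le_left (by positivity)]
  nlinarith [mul_nonneg ha hη]

/-- **The shifted modulus loses little mass**: `a² ≤ (√(a²+η²) - η)² + η(a² + 1)` for `η ≥ 0`
(if `a ≥ η` then `(a-η)² ≥ a² - 2aη ≥ a² - η(a²+1)`; if `a < η` then `a² ≤ ηa ≤ η(a²+1)`; here in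
one stroke from `(a² - 1)² + 4η(a² + 1) ≥ 0`). [folklore] -/
theorem sq_le_shiftedModulus_sq_add (a : ℝ) {η : ℝ} (hη : 0 ≤ η) :
    a ^ 2 ≤ (Real.sqrt (a ^ 2 + η ^ 2) - η) ^ 2 + η * (a ^ 2 + 1) := by
  set s := Real.sqrt (a ^ 2 + η ^ 2) with hs
  have hs0 : 0 ≤ s := Real.sqrt_nonneg _
  have hs2 : s ^ 2 = a ^ 2 + η ^ 2 := Real.sq_sqrt (by positivity)
  -- `2s ≤ a² + 1 + 2η`
  have h2s : 2 * s ≤ a ^ 2 + 1 + 2 * η := by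
    have hR : 0 ≤ a ^ 2 + 1 + 2 * η := by positivity
    nlinarith [sq_nonneg (a ^ 2 - 1), sq_nonneg (2 * s - (a ^ 2 + 1 + 2 * η)), mul_nonneg hη (sq_nonneg a)]
  nlinarith [mul_nonneg hη (by linarith : 0 ≤ a ^ 2 + 1 + 2 * η - 2 * s)]

/-! ### The derivative of the shifted modulus -/

/-- **Smooth diamagnetic inequality, shifted form**: for differentiable `Ψ : (ℝ³)^N → ℂ` and `η > 0`
the real `C¹` function `√(|Ψ|² + η²) - η` (read in `ℂ`) has directional derivatives dominated by
those of `Ψ`: `|∂_h(√(|Ψ|²+η²) - η)| = |Re⟨Ψ, ∂_hΨ⟩| / √(|Ψ|²+η²) ≤ |∂_h Ψ|`. [folklore] -/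
theorem norm_fderiv_shiftedModulus_apply_le {Ψ : Config N → ℂ} (hΨ : Differentiable ℝ Ψ)
    {η : ℝ} (hη : 0 < η) (X h : Config N) :
    ‖fderiv ℝ (fun Y => ((Real.sqrt (‖Ψ Y‖ ^ 2 + η ^ 2) - η : ℝ) : ℂ)) X h‖ ≤ ‖fderiv ℝ Ψ X h‖ := by
  set s : ℝ := Real.sqrt (‖Ψ X‖ ^ 2 + η ^ 2) with hs
  have hpos : 0 < ‖Ψ X‖ ^ 2 + η ^ 2 := by positivity
  have hs0 : 0 < s := Real.sqrt_pos.2 hpos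
  have hΨs : ‖Ψ X‖ ≤ s := by
    rw [hs, Real.le_sqrt (norm_nonneg _) hpos.le]
    nlinarith [sq_nonneg η]
  have h1 := ((hΨ X).hasFDerivAt.norm_sq).add_const (η ^ 2)
  have h2 := (h1.sqrt hpos.ne').sub_const η
  have h4 : HasFDerivAt (fun Y => ((Real.sqrt (‖Ψ Y‖ ^ 2 + η ^ 2) - η : ℝ) : ℂ)) _ X :=
    Complex.ofRealCLM.hasFDerivAt.comp X h2
  rw [h4.fderiv]
  simp only [ContinuousLinearMap.comp_apply, _root_.smul_apply, two_smul, _root_.add_apply,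
    innerSL_apply_apply, Complex.ofRealCLM_apply, smul_eq_mul, Complex.norm_real, Real.norm_eq_abs]
  set I : ℝ := ⟪Ψ X, fderiv ℝ Ψ X h⟫_ℝ with hI
  have hIle : |I| ≤ ‖Ψ X‖ * ‖fderiv ℝ Ψ X h‖ := abs_real_inner_le_norm _ _
  have heq : 1 / (2 * s) * (I + I) = I / s := by
    field_simp
    ring
  rw [← hs, heq, abs_div, abs_of_pos hs0, div_le_iff₀ hs0]
  calc |I| ≤ ‖Ψ X‖ * ‖fderiv ℝ Ψ X h‖ := hIle
    _ = ‖fderiv ℝ Ψ X h‖ * ‖Ψ X‖ := by ring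
    _ ≤ ‖fderiv ℝ Ψ X h‖ * s := mul_le_mul_of_nonneg_left hΨs (norm_nonneg _)

/-- **The shifted modulus does not increase the kinetic density**:
`|∇(√(|Ψ|²+η²) - η)|² ≤ |∇Ψ|²` pointwise. [folklore] -/
theorem kineticDensity_shiftedModulus_le {Ψ : Config N → ℂ} (hΨ : Differentiable ℝ Ψ)
    {η : ℝ} (hη : 0 < η) (X : Config N) :
    kineticDensity (fun Y => ((Real.sqrt (‖Ψ Y‖ ^ 2 + η ^ 2) - η : ℝ) : ℂ)) X ≤ kineticDensity Ψ X := by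
  unfold kineticDensity
  refine Finset.sum_le_sum fun i _ => Finset.sum_le_sum fun k _ => ?_
  have h := norm_fderiv_shiftedModulus_apply_le hΨ hη X (Pi.single i (EuclideanSpace.single k (1 : ℝ)))
  gcongr
  rw [← NNReal.coe_le_coe, coe_nnnorm, coe_nnnorm]
  exact h

/-! ### Nonnegative near-minimisers for every pair potential -/

/-- **Nonnegative near-minimisers exist for every pair potential with finite ground-state energy**
(hard cores included). For any profile `v : ℝ → [0,∞]`, `L > 0`, any `N`, finite
`E₀ = periodicGroundStateEnergy v N L` and `δ > 0`, there is a periodic `C¹` Bose trial state `Φ`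
which is pointwise a nonnegative real and has `periodicEnergy v Φ ≤ E₀ + δ`: normalise the shifted
modulus `f = √(|Ψ|² + η²) - η` of a `δ'/2`-near-minimiser `Ψ` (`δ' = min δ 1`), using
`q(f) ≤ periodicEnergy v Ψ` (`0 ≤ f ≤ |Ψ|`, `|∇f| ≤ |∇Ψ|`) and `‖f‖²_cell ≥ 1 - η(1 + L^{3N})` with
`η(1 + L^{3N})(E₀ + δ') < δ'/2`. [folklore] -/
theorem exists_nonneg_nearMinimiser_of_ne_top (v : ℝ → ℝ≥0∞) (hL : 0 < L)
    (hE : periodicGroundStateEnergy v N L ≠ ⊤) {δ : ℝ≥0∞} (hδ : 0 < δ) :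
    ∃ Φ : PeriodicTrialState N L, (∀ X, Φ.ψ X = ((‖Φ.ψ X‖ : ℝ) : ℂ)) ∧
      periodicEnergy v Φ ≤ periodicGroundStateEnergy v N L + δ := by
  -- reduce to a finite slack `δ' = min δ 1`
  set δ' : ℝ≥0∞ := min δ 1 with hδ'
  have hδ'0 : 0 < δ' := lt_min hδ one_pos
  have hδ'top : δ' ≠ ⊤ := ne_top_of_le_ne_top ENNReal.one_ne_top (min_le_right _ _)
  suffices h : ∃ Φ : PeriodicTrialState N L, (∀ X, Φ.ψ X = ((‖Φ.ψ X‖ : ℝ) : ℂ)) ∧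
      periodicEnergy v Φ ≤ periodicGroundStateEnergy v N L + δ' by
    obtain ⟨Φ, h1, h2⟩ := h
    exact ⟨Φ, h1, h2.trans (add_le_add le_rfl (min_le_left _ _))⟩
  set E₀ := periodicGroundStateEnergy v N L with hE₀
  set B : ℝ≥0∞ := E₀ + δ' with hB
  have hBtop : B ≠ ⊤ := ENNReal.add_ne_top.2 ⟨hE, hδ'top⟩
  have hδ2 : δ' / 2 ≠ 0 := (ENNReal.half_pos hδ'0.ne').ne'
  have hδ2top : δ' / 2 ≠ ⊤ := ENNReal.div_ne_top hδ'top two_ne_zero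
  -- a `δ'/2`-near-minimiser
  obtain ⟨Ψ, hΨ⟩ : ∃ Ψ : PeriodicTrialState N L, periodicEnergy v Ψ < E₀ + δ' / 2 :=
    iInf_lt_iff.1 (ENNReal.lt_add_right hE hδ2)
  -- the parameter: `κ = η (1 + V)` with `κ B < δ'/2`
  set V : ℝ := (L ^ 3) ^ N with hV
  have hV0 : 0 < V := by positivity
  obtain ⟨κ, hκ0, hκ⟩ := ENNReal.exists_nnreal_pos_mul_lt hBtop hδ2
  set η : ℝ := (κ : ℝ) / (1 + V) with hη
  have hη0 : 0 < η := div_pos (by exact_mod_cast hκ0) (by positivity)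
  have hηκ : ENNReal.ofReal (η * (1 + V)) = (κ : ℝ≥0∞) := by
    rw [hη, div_mul_cancel₀ _ (by positivity), ENNReal.ofReal_coe_nnreal]
  -- `κ < 1` (indeed `κ δ' ≤ κ B < δ'/2`)
  have hκ1 : (κ : ℝ≥0∞) < 1 := by
    by_contra hge
    rw [not_lt] at hge
    have h1 : δ' ≤ (κ : ℝ≥0∞) * B := by
      calc δ' = 1 * δ' := (one_mul _).symm
        _ ≤ (κ : ℝ≥0∞) * B := mul_le_mul' hge le_add_self
    have h2 : δ' < δ' / 2 := h1.trans_lt hκ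
    exact absurd (ENNReal.half_le_self) (not_le.2 h2)
  -- the shifted modulus
  obtain ⟨f, hf⟩ : ∃ f : Config N → ℝ, f = fun X => Real.sqrt (‖Ψ.ψ X‖ ^ 2 + η ^ 2) - η := ⟨_, rfl⟩
  have hf0 : ∀ X, 0 ≤ f X := fun X => by rw [hf]; exact shiftedModulus_nonneg _ hη0.le
  have hfle : ∀ X, f X ≤ ‖Ψ.ψ X‖ := fun X => by rw [hf]; exact shiftedModulus_le (norm_nonneg _) hη0.le
  have hfC : ContDiff ℝ 1 f := by
    rw [hf]
    exact (((Ψ.contDiff.norm_sq ℂ).add contDiff_const).sqrt fun X => by positivity).sub contDiff_const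
  have huC : ContDiff ℝ 1 fun X => ((f X : ℝ) : ℂ) := Complex.ofRealCLM.contDiff.comp hfC
  have hucont : Continuous fun X => ((f X : ℝ) : ℂ) := huC.continuous
  have huper : ∀ (X : Config N) (i : Fin N) (k : Fin 3),
      ((f (X + Pi.single i (EuclideanSpace.single k L)) : ℝ) : ℂ) = ((f X : ℝ) : ℂ) := fun X i k => by
    simp only [hf, Ψ.periodic]
  have husymm : ∀ (σ : Equiv.Perm (Fin N)) (X : Config N), ((f (X ∘ σ) : ℝ) : ℂ) = ((f X : ℝ) : ℂ) :=
    fun σ X => by simp only [hf, Ψ.symm]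
  -- pointwise comparisons in `ℝ≥0∞`
  have hsq_le : ∀ X, ((‖((f X : ℝ) : ℂ)‖₊ : ℝ≥0∞)) ^ 2 ≤ ((‖Ψ.ψ X‖₊ : ℝ≥0∞)) ^ 2 := fun X => by
    rw [ennnorm_sq_ofReal_sm, coe_nnnorm_sq_eq_ofReal]
    exact ENNReal.ofReal_le_ofReal (pow_le_pow_left₀ (hf0 X) (hfle X) 2)
  have hsq_ge : ∀ X, ((‖Ψ.ψ X‖₊ : ℝ≥0∞)) ^ 2 ≤
      ((‖((f X : ℝ) : ℂ)‖₊ : ℝ≥0∞)) ^ 2 + ENNReal.ofReal η * (((‖Ψ.ψ X‖₊ : ℝ≥0∞)) ^ 2 + 1) := by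
    intro X
    rw [ennnorm_sq_ofReal_sm, coe_nnnorm_sq_eq_ofReal, ← ENNReal.ofReal_one,
      ← ENNReal.ofReal_add (by positivity) zero_le_one, ← ENNReal.ofReal_mul hη0.le,
      ← ENNReal.ofReal_add (by positivity) (by positivity)]
    refine ENNReal.ofReal_le_ofReal ?_
    have h := sq_le_shiftedModulus_sq_add ‖Ψ.ψ X‖ hη0.le
    rw [hf]
    exact h
  -- the cell norm `I` of `f`: `I ≤ 1`, `1 ≤ I + κ`
  set I : ℝ≥0∞ := ∫⁻ X in cellN N L, ((‖((f X : ℝ) : ℂ)‖₊ : ℝ≥0∞)) ^ 2 with hI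
  have hmeasΨ : Measurable fun X => ((‖Ψ.ψ X‖₊ : ℝ≥0∞)) ^ 2 :=
    (Ψ.contDiff.continuous.measurable.nnnorm.coe_nnreal_ennreal).pow_const 2
  have hI1 : I ≤ 1 := by
    calc I ≤ ∫⁻ X in cellN N L, ((‖Ψ.ψ X‖₊ : ℝ≥0∞)) ^ 2 := lintegral_mono fun X => hsq_le X
      _ = 1 := Ψ.norm_eq
  have hItop : I ≠ ⊤ := ne_top_of_le_ne_top ENNReal.one_ne_top hI1
  have hIκ : 1 ≤ I + κ := by
    calc (1 : ℝ≥0∞) = ∫⁻ X in cellN N L, ((‖Ψ.ψ X‖₊ : ℝ≥0∞)) ^ 2 := Ψ.norm_eq.symm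
      _ ≤ ∫⁻ X in cellN N L, ((‖((f X : ℝ) : ℂ)‖₊ : ℝ≥0∞)) ^ 2 +
            ENNReal.ofReal η * (((‖Ψ.ψ X‖₊ : ℝ≥0∞)) ^ 2 + 1) := lintegral_mono fun X => hsq_ge X
      _ = I + ENNReal.ofReal η * (1 + ENNReal.ofReal V) := by
          have hm1 : Measurable fun X => ((‖Ψ.ψ X‖₊ : ℝ≥0∞)) ^ 2 + 1 := hmeasΨ.add measurable_const
          have hm2 : Measurable fun X => ENNReal.ofReal η * (((‖Ψ.ψ X‖₊ : ℝ≥0∞)) ^ 2 + 1) :=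
            hm1.const_mul _
          rw [lintegral_add_right _ hm2, lintegral_const_mul _ hm1, lintegral_add_right _ measurable_const,
            Ψ.norm_eq, setLIntegral_const, volume_cellN, one_mul, ← ENNReal.ofReal_pow hL.le,
            ← ENNReal.ofReal_pow (by positivity)]
      _ = I + κ := by
          rw [← ENNReal.ofReal_one, ← ENNReal.ofReal_add zero_le_one hV0.le, ← ENNReal.ofReal_mul hη0.le,
            hηκ]
  have hI0 : I ≠ 0 := by
    intro h0
    rw [h0, zero_add] at hIκ
    exact absurd hκ1 (not_lt.2 hIκ)
  -- normalise: `Φ = a f`, `a = ‖f‖⁻¹_cell > 0`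
  have hIpos : 0 < I.toReal := ENNReal.toReal_pos hI0 hItop
  set a : ℝ := (Real.sqrt I.toReal)⁻¹ with ha
  have ha0 : 0 < a := by positivity
  have ha2 : ((‖(a : ℂ)‖₊ : ℝ≥0∞)) ^ 2 = I⁻¹ := by
    rw [ennnorm_sq_ofReal_sm, ha, inv_pow, Real.sq_sqrt hIpos.le, ENNReal.ofReal_inv_of_pos hIpos,
      ENNReal.ofReal_toReal hItop]
  let Φ : PeriodicTrialState N L :=
    { ψ := fun X => (a : ℂ) * ((f X : ℝ) : ℂ)
      contDiff := contDiff_const.mul huC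
      periodic := fun X i k => by simp only [huper]
      symm := fun σ X => by simp only [husymm]
      norm_eq := by
        rw [lintegral_cellN_sq_const_mul, ha2, ENNReal.inv_mul_cancel hI0 hItop] }
  refine ⟨Φ, fun X => ?_, ?_⟩
  · show (a : ℂ) * ((f X : ℝ) : ℂ) = ((‖(a : ℂ) * ((f X : ℝ) : ℂ)‖ : ℝ) : ℂ)
    rw [← Complex.ofReal_mul, Complex.norm_real, Real.norm_of_nonneg (mul_nonneg ha0.le (hf0 X))]
  · -- the energy: `periodicEnergy v Φ = I⁻¹ q(f) ≤ I⁻¹ periodicEnergy v Ψ ≤ E₀ + δ'`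
    have hq : (∫⁻ X in cellN N L, kineticDensity (fun Y => ((f Y : ℝ) : ℂ)) X +
        periodicInteraction v L X * ((‖((f X : ℝ) : ℂ)‖₊ : ℝ≥0∞)) ^ 2) ≤ periodicEnergy v Ψ := by
      refine lintegral_mono fun X => add_le_add ?_ (mul_le_mul' le_rfl (hsq_le X))
      rw [hf]
      exact kineticDensity_shiftedModulus_le (Ψ.contDiff.differentiable one_ne_zero) hη0 X
    have hEΦ : periodicEnergy v Φ = I⁻¹ * ∫⁻ X in cellN N L, kineticDensity (fun Y => ((f Y : ℝ) : ℂ)) X +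
        periodicInteraction v L X * ((‖((f X : ℝ) : ℂ)‖₊ : ℝ≥0∞)) ^ 2 := by
      rw [← ha2]
      exact lintegral_periodicEnergy_const_mul v L (a : ℂ) huC
    rw [hEΦ, ENNReal.inv_mul_le_iff hI0 hItop]
    refine hq.trans (hΨ.le.trans ?_)
    -- `E₀ + δ'/2 ≤ I B`: from `B ≤ (I + κ) B = I B + κ B < I B + δ'/2`
    have h1 : E₀ + δ' / 2 + δ' / 2 ≤ I * B + κ * B := by
      calc E₀ + δ' / 2 + δ' / 2 = B := by rw [add_assoc, ENNReal.add_halves]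
        _ = 1 * B := (one_mul _).symm
        _ ≤ (I + κ) * B := mul_le_mul' hIκ le_rfl
        _ = I * B + κ * B := add_mul _ _ _
    have h2 : E₀ + δ' / 2 + δ' / 2 < I * B + δ' / 2 := h1.trans_lt (ENNReal.add_lt_add_left
      (ENNReal.mul_ne_top hItop hBtop) hκ)
    exact (ENNReal.add_lt_add_iff_right hδ2top).1 h2 |>.le

end Summit.AtomisticToContinuum.BoseEinsteinCondensation.Theorems

end
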